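import Mathlib.AlgebraicGeometry.Morphisms.Separated
import Mathlib.AlgebraicGeometry.Morphisms.SchemeTheoreticallyDominant
import Literature.AlgebraicGeometry.Limits.IdealSheafExtension
import Literature.AlgebraicGeometry.Motives.GenericFibre
import HarnessLib

/-!
# Morphisms which are isomorphisms over an open of the target; schematically dominant sections

Topic: `Literature/AlgebraicGeometry/Morphisms`. Bookkeeping used throughout the Stacks
Project's proof of Nagata's compactification theorem (Tags 0F3W–0F41: "`f|_U : U → V` is an
isomorphism over an open neighbourhood of `T`", "`ψᵢ` is an isomorphism over an open
neighbourhood of `Zᵢ`", "the projections `pᵢ : X₁₂ → Xᵢ` induce isomorphisms `pᵢ⁻¹(U) → U` by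
Morphisms, Lemma 6.8") for the condition "`f : X → S` is an isomorphism over the open `U ⊆ S`",
rendered as `IsIso (f ∣_ U)`, and the scheme-theoretic form of Stacks, Tag 01RH (Morphisms,
Lemma 29.6.8: a quasi-compact immersion followed by its scheme-theoretic image) — all PROVED
over Mathlib:

* `isIso_morphismRestrict_comp`, `isIso_morphismRestrict_of_le`,
  `isIso_morphismRestrict_pullback_snd`, `isIso_morphismRestrict_pullback_fst` — isomorphisms
  over an open compose, restrict to smaller opens and base-change;
* `ker_morphismRestrict_eq_comap` — the kernel of `f|_U` is the restriction of the kernel;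
* `isIso_lift_of_section`, `isIso_morphismRestrict_of_section` — **a scheme-theoretically
  dominant section `h : U → X'` of a separated `π : X' → X` over an open `U ⊆ X` identifies `U`
  with `π⁻¹(U)`**; in particular `π` is an isomorphism over `U` (the schematic version of
  Görtz–Wedhorn, proof of Thm. 13.100, Step 3, which the tree has for `X'` reduced and `h`
  dominant: `Resolution.ChowLemmaProof.isIso_morphismRestrict_of_section`);
* `isIso_imageι_morphismRestrict` — the scheme-theoretic image of a quasi-compact open `O ↪ T`
  restricts to `O` over `O`;
* `GraphClosure.isIso_morphismRestrict`, `GraphClosure.isOpenImmersion_toImage`,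
  `GraphClosure.isPullback_toImage` — **Stacks 01RH in the form used in Tags 0A9Z/0F3Z/0F40**:
  for `j : V → Y` an open immersion, `π : P → Y` separated and `γ : V → P` quasi-compact with
  `γ ≫ π = j`, the scheme-theoretic image `Z` of `γ` satisfies: `Z → Y` is an isomorphism over
  `j(V)`, and `V → Z` is an open immersion onto the preimage of `j(V)` (the square
  `V → Z, 𝟙, Z → Y, j` is cartesian). No reducedness hypothesis (the tree's
  `Resolution.exists_graphClosure_compactification` assumes `V` integral).

## References

* The Stacks Project, Tag 01RH (Morphisms, Lemma 29.6.8), Tag 0F3Z, Tag 0F40. [StacksProject]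
* U. Görtz, T. Wedhorn, *Algebraic Geometry I*, 2nd ed. (2020), proof of Thm. 13.100, Step 3.
  [GortzWedhorn2020]
-/

noncomputable section

-- Mathlib's pull-back API is stated through `abbrev`s over `limit`; as in Mathlib's own
-- algebraic-geometry files we let `simp`/unification see through them.
set_option backward.isDefEq.respectTransparency false

universe u

open CategoryTheory CategoryTheory.Limits AlgebraicGeometry TopologicalSpace

namespace Literature.AlgebraicGeometry.Morphisms

/-! ## Isomorphisms over an open: composition, restriction, base change -/

section IsoOver

variable {X Y Z : Scheme.{u}}

/-- If `f` is an isomorphism over `g⁻¹U` and `g` is an isomorphism over `U` then `f ≫ g` is an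
isomorphism over `U`. [folklore] -/
theorem isIso_morphismRestrict_comp (f : X ⟶ Y) (g : Y ⟶ Z) (U : Z.Opens)
    [IsIso (f ∣_ g ⁻¹ᵁ U)] [IsIso (g ∣_ U)] : IsIso ((f ≫ g) ∣_ U) := by
  rw [morphismRestrict_comp]
  infer_instance

/-- A property local on the target passes from `f|_U` to `f|_V` for `V ≤ U`. [folklore] -/
theorem of_morphismRestrict_of_le (P : MorphismProperty Scheme.{u}) [IsZariskiLocalAtTarget P]
    (f : X ⟶ Y) {U V : Y.Opens} (hUV : V ≤ U) (hf : P (f ∣_ U)) : P (f ∣_ V) := by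
  have h1 : P ((f ∣_ U) ∣_ (U.ι ⁻¹ᵁ V)) := IsZariskiLocalAtTarget.restrict hf _
  have h2 : P (f ∣_ (U.ι ''ᵁ (U.ι ⁻¹ᵁ V))) :=
    (P.arrow_mk_iso_iff (morphismRestrictRestrict f U (U.ι ⁻¹ᵁ V))).mp h1
  have hV : U.ι ''ᵁ (U.ι ⁻¹ᵁ V) = V := by
    rw [Scheme.Hom.image_preimage_eq_opensRange_inf, Scheme.Opens.opensRange_ι, inf_eq_right]
    exact hUV
  exact (P.arrow_mk_iso_iff (morphismRestrictEq f hV)).mp h2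

/-- An isomorphism over `U` is an isomorphism over every smaller open. [folklore] -/
theorem isIso_morphismRestrict_of_le (f : X ⟶ Y) {U V : Y.Opens} (hUV : V ≤ U)
    [IsIso (f ∣_ U)] : IsIso (f ∣_ V) :=
  (MorphismProperty.isomorphisms.iff _).mp
    (of_morphismRestrict_of_le (MorphismProperty.isomorphisms Scheme.{u}) f hUV
      ((MorphismProperty.isomorphisms.iff _).mpr inferInstance))

/-- **A property stable under base change passes from `f|_U` to `(X ×_S Y)|_{g⁻¹U} → g⁻¹U`**
(the restriction of the base change `X ×_S Y → Y` over `g⁻¹U` is the base change of `f|_U`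
along `g|_U`). [folklore] -/
theorem pullback_snd_morphismRestrict (P : MorphismProperty Scheme.{u})
    [P.IsStableUnderBaseChange] {S : Scheme.{u}} (f : X ⟶ S) (g : Y ⟶ S) (U : S.Opens)
    (hP : P (f ∣_ U)) : P ((pullback.snd f g) ∣_ (g ⁻¹ᵁ U)) := by
  have outer : IsPullback (((pullback.snd f g) ⁻¹ᵁ (g ⁻¹ᵁ U)).ι ≫ pullback.fst f g)
      ((pullback.snd f g) ∣_ (g ⁻¹ᵁ U)) f ((g ⁻¹ᵁ U).ι ≫ g) :=
    (isPullback_morphismRestrict (pullback.snd f g) (g ⁻¹ᵁ U)).flip.paste_horiz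
      (IsPullback.of_hasPullback f g)
  rw [← morphismRestrict_ι] at outer
  exact P.of_isPullback (IsPullback.of_right' outer (isPullback_morphismRestrict f U).flip) hP

/-- The same for the first projection: `P (g|_U) → P ((X ×_S Y → X)|_{f⁻¹U})`. [folklore] -/
theorem pullback_fst_morphismRestrict (P : MorphismProperty Scheme.{u})
    [P.IsStableUnderBaseChange] {S : Scheme.{u}} (f : X ⟶ S) (g : Y ⟶ S) (U : S.Opens)
    (hP : P (g ∣_ U)) : P ((pullback.fst f g) ∣_ (f ⁻¹ᵁ U)) := by
  have outer : IsPullback (((pullback.fst f g) ⁻¹ᵁ (f ⁻¹ᵁ U)).ι ≫ pullback.snd f g)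
      ((pullback.fst f g) ∣_ (f ⁻¹ᵁ U)) g ((f ⁻¹ᵁ U).ι ≫ f) :=
    (isPullback_morphismRestrict (pullback.fst f g) (f ⁻¹ᵁ U)).flip.paste_horiz
      (IsPullback.of_hasPullback f g).flip
  rw [← morphismRestrict_ι] at outer
  exact P.of_isPullback (IsPullback.of_right' outer (isPullback_morphismRestrict g U).flip) hP

/-- Base change of an isomorphism over `U`: `(X ×_S Y → Y)` is an isomorphism over `g⁻¹U`.
[folklore] -/
theorem isIso_morphismRestrict_pullback_snd {S : Scheme.{u}} (f : X ⟶ S) (g : Y ⟶ S)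
    (U : S.Opens) [IsIso (f ∣_ U)] : IsIso ((pullback.snd f g) ∣_ (g ⁻¹ᵁ U)) :=
  (MorphismProperty.isomorphisms.iff _).mp
    (pullback_snd_morphismRestrict (MorphismProperty.isomorphisms Scheme.{u}) f g U
      ((MorphismProperty.isomorphisms.iff _).mpr inferInstance))

/-- Base change of an isomorphism over `U`: `(X ×_S Y → X)` is an isomorphism over `f⁻¹U`.
[folklore] -/
theorem isIso_morphismRestrict_pullback_fst {S : Scheme.{u}} (f : X ⟶ S) (g : Y ⟶ S)
    (U : S.Opens) [IsIso (g ∣_ U)] : IsIso ((pullback.fst f g) ∣_ (f ⁻¹ᵁ U)) :=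
  (MorphismProperty.isomorphisms.iff _).mp
    (pullback_fst_morphismRestrict (MorphismProperty.isomorphisms Scheme.{u}) f g U
      ((MorphismProperty.isomorphisms.iff _).mpr inferInstance))

end IsoOver

/-! ## Kernels of restrictions; schematically dominant corestrictions -/

section Ker

variable {X Y : Scheme.{u}}

/-- The kernel of the restriction `f|_U : f⁻¹U → U` of a quasi-compact morphism is the
restriction of the kernel. [folklore] -/
theorem ker_morphismRestrict_eq_comap (f : X ⟶ Y) [QuasiCompact f] (U : Y.Opens) :
    (f ∣_ U).ker = f.ker.comap U.ι := by
  refine Scheme.IdealSheafData.ext (funext fun W => ?_)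
  rw [Scheme.ker_ideal_of_isPullback_of_isOpenImmersion f (f ∣_ U) (f ⁻¹ᵁ U).ι U.ι
    (isPullback_morphismRestrict f U) W, Scheme.IdealSheafData.ideal_comap_of_isOpenImmersion]

/-- If `h' ≫ ι = h` with `ι` a quasi-compact open immersion and `h` scheme-theoretically
dominant, then `h'` is scheme-theoretically dominant. [folklore] -/
theorem IsSchemeTheoreticallyDominant.of_comp_isOpenImmersion {W X₀ : Scheme.{u}} (h' : W ⟶ X₀)
    (ι : X₀ ⟶ X) [IsOpenImmersion ι] [QuasiCompact ι] [IsSchemeTheoreticallyDominant (h' ≫ ι)] :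
    IsSchemeTheoreticallyDominant h' := by
  refine ⟨?_⟩
  rw [← Limits.comap_map_of_isOpenImmersion ι h'.ker, Scheme.IdealSheafData.map_ker,
    (h' ≫ ι).ker_eq_bot, Scheme.IdealSheafData.comap_bot]

end Ker

/-! ## A schematically dominant section of a separated morphism over an open -/

section Section

variable {X X' : Scheme.{u}} (π : X' ⟶ X) [IsSeparated π] (U : X.Opens) (h : U.toScheme ⟶ X')
  (w : h ≫ π = U.ι)

omit [IsSeparated π] in
include w in
/-- The image of a section over `U` lies in `π⁻¹(U)`. [folklore] -/
theorem range_subset_of_section : Set.range h ⊆ Set.range (π ⁻¹ᵁ U).ι := by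
  rw [Scheme.Opens.range_ι]
  rintro _ ⟨x, rfl⟩
  have hx : π (h x) = x.1 := by rw [← Scheme.Hom.comp_apply, w, Scheme.Opens.ι_apply]
  show π (h x) ∈ U
  rw [hx]
  exact x.2

include w in
/-- **A scheme-theoretically dominant section over `U` of a separated morphism is an
isomorphism onto `π⁻¹(U)`**: the corestriction `U → π⁻¹(U)` is a section of the separated
`π⁻¹(U) → U`, hence a closed immersion, with trivial kernel (it is schematically dominant, the
open immersion `π⁻¹(U) ↪ X'` being quasi-compact), hence an isomorphism.
[cite: GortzWedhorn2020, Thm 13.100 (proof, Step 3)] -/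
theorem isIso_lift_of_section [IsSchemeTheoreticallyDominant h] [QuasiCompact (π ⁻¹ᵁ U).ι] :
    IsIso (IsOpenImmersion.lift (π ⁻¹ᵁ U).ι h (range_subset_of_section π U h w)) := by
  set h' := IsOpenImmersion.lift (π ⁻¹ᵁ U).ι h (range_subset_of_section π U h w) with hh'
  have h'ι : h' ≫ (π ⁻¹ᵁ U).ι = h := IsOpenImmersion.lift_fac _ _ _
  haveI : IsSchemeTheoreticallyDominant (h' ≫ (π ⁻¹ᵁ U).ι) := by rw [h'ι]; infer_instance
  haveI : IsSchemeTheoreticallyDominant h' :=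
    IsSchemeTheoreticallyDominant.of_comp_isOpenImmersion h' (π ⁻¹ᵁ U).ι
  have hsec : h' ≫ (π ∣_ U) = 𝟙 _ := by
    rw [← cancel_mono U.ι, Category.assoc, morphismRestrict_ι, ← Category.assoc, h'ι, w,
      Category.id_comp]
  haveI : IsClosedImmersion h' := by
    have : IsClosedImmersion (h' ≫ (π ∣_ U)) := by rw [hsec]; infer_instance
    exact IsClosedImmersion.of_comp h' (π ∣_ U)
  exact IsClosedImmersion.isIso_iff_ker_eq_bot.mpr (IsSchemeTheoreticallyDominant.ker_eq_bot _)

include w in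
/-- **A separated morphism with a scheme-theoretically dominant section over `U` is an
isomorphism over `U`.** [cite: GortzWedhorn2020, Thm 13.100 (proof, Step 3)] -/
theorem isIso_morphismRestrict_of_section [IsSchemeTheoreticallyDominant h]
    [QuasiCompact (π ⁻¹ᵁ U).ι] : IsIso (π ∣_ U) := by
  haveI := isIso_lift_of_section π U h w
  set h' := IsOpenImmersion.lift (π ⁻¹ᵁ U).ι h (range_subset_of_section π U h w) with hh'
  have h'ι : h' ≫ (π ⁻¹ᵁ U).ι = h := IsOpenImmersion.lift_fac _ _ _
  have hsec : h' ≫ (π ∣_ U) = 𝟙 _ := by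
    rw [← cancel_mono U.ι, Category.assoc, morphismRestrict_ι, ← Category.assoc, h'ι, w,
      Category.id_comp]
  have : π ∣_ U = inv h' ≫ (h' ≫ (π ∣_ U)) := by simp
  rw [this, hsec]
  infer_instance

end Section

/-- **The scheme-theoretic image of a quasi-compact open `O ↪ T` restricts to `O` over `O`**:
the closed immersion `im(O ↪ T) → T` is an isomorphism over `O`. [cite: StacksProject, Tag 01RG] -/
theorem isIso_imageι_morphismRestrict {T : Scheme.{u}} (O : T.Opens) [QuasiCompact O.ι] :
    IsIso (O.ι.imageι ∣_ O) := by
  haveI := Motives.isSchemeTheoreticallyDominant_toImage O.ι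
  haveI : QuasiCompact (O.ι.imageι ⁻¹ᵁ O).ι := by
    -- `imageι⁻¹(O) → im → T` has image in `O`... it is the base change of `O ↪ T` along `imageι`
    exact MorphismProperty.of_isPullback (isPullback_morphismRestrict O.ι.imageι O) inferInstance
  exact isIso_morphismRestrict_of_section O.ι.imageι O O.ι.toImage O.ι.toImage_imageι

/-! ## The scheme-theoretic image of the graph of a morphism on an open (Stacks 01RH) -/

namespace GraphClosure

variable {V Y P : Scheme.{u}} (j : V ⟶ Y) [IsOpenImmersion j] (π : P ⟶ Y) [IsSeparated π]
  (γ : V ⟶ P) [QuasiCompact γ] (hγ : γ ≫ π = j)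

include hγ in
/-- **`im(γ) → Y` is an isomorphism over `j(V)`** (for `V` quasi-compact over `Y`): `V → im(γ)`
is a scheme-theoretically dominant section of the separated `im(γ) → Y` over the open `j(V)`.
[cite: StacksProject, Tag 01RH] -/
theorem isIso_morphismRestrict [QuasiCompact j] : IsIso ((γ.imageι ≫ π) ∣_ j.opensRange) := by
  haveI := Motives.isSchemeTheoreticallyDominant_toImage γ
  haveI : IsSeparated (γ.imageι ≫ π) := inferInstance
  haveI : IsSchemeTheoreticallyDominant (j.isoOpensRange.inv ≫ γ.toImage) := inferInstance
  haveI : QuasiCompact ((γ.imageι ≫ π) ⁻¹ᵁ j.opensRange).ι := by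
    haveI : QuasiCompact j.opensRange.ι := by
      rw [← Scheme.Hom.isoOpensRange_inv_comp j]
      infer_instance
    exact MorphismProperty.of_isPullback (isPullback_morphismRestrict (γ.imageι ≫ π) j.opensRange)
      inferInstance
  refine isIso_morphismRestrict_of_section (γ.imageι ≫ π) j.opensRange
    (j.isoOpensRange.inv ≫ γ.toImage) ?_
  rw [Category.assoc, Scheme.Hom.toImage_imageι_assoc, hγ, Scheme.Hom.isoOpensRange_inv_comp]

include hγ in
/-- **The corestriction `V → im(γ)` is an open immersion onto the preimage of `j(V)`.**
[cite: StacksProject, Tag 01RH] -/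
theorem isOpenImmersion_toImage_and_range [QuasiCompact j] :
    IsOpenImmersion γ.toImage ∧
      Set.range γ.toImage = (((γ.imageι ≫ π) ⁻¹ᵁ j.opensRange : γ.image.Opens) : Set γ.image) := by
  set pr : γ.image ⟶ Y := γ.imageι ≫ π with hpr
  set U : Y.Opens := j.opensRange
  haveI hiso := isIso_morphismRestrict j π γ hγ
  -- `V → im(γ)` factors through the open `pr⁻¹(U)`
  have hrange : Set.range γ.toImage ⊆ Set.range (pr ⁻¹ᵁ U).ι := by
    rw [Scheme.Opens.range_ι]
    rintro _ ⟨x, rfl⟩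
    show pr (γ.toImage x) ∈ U
    rw [← Scheme.Hom.comp_apply, hpr, Scheme.Hom.toImage_imageι_assoc, hγ]
    exact ⟨x, rfl⟩
  set s' := IsOpenImmersion.lift (pr ⁻¹ᵁ U).ι γ.toImage hrange with hs'
  have hs'ι : s' ≫ (pr ⁻¹ᵁ U).ι = γ.toImage := IsOpenImmersion.lift_fac _ _ _
  -- and there it is `V ≅ U` followed by the inverse of the isomorphism `pr⁻¹(U) → U`
  have hs'pr : s' ≫ (pr ∣_ U) = j.isoOpensRange.hom := by
    rw [← cancel_mono U.ι, Category.assoc, morphismRestrict_ι, ← Category.assoc, hs'ι, hpr,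
      Scheme.Hom.toImage_imageι_assoc, hγ]
    exact (Scheme.Hom.isoOpensRange_hom_ι j).symm
  haveI : IsIso s' := by
    have h : s' = j.isoOpensRange.hom ≫ inv (pr ∣_ U) := by
      rw [← hs'pr, Category.assoc, IsIso.hom_inv_id, Category.comp_id]
    rw [h]
    infer_instance
  have hs : γ.toImage = s' ≫ (pr ⁻¹ᵁ U).ι := hs'ι.symm
  refine ⟨by rw [hs]; infer_instance, ?_⟩
  rw [← Scheme.Opens.range_ι (pr ⁻¹ᵁ U), hs]
  apply le_antisymm
  · rintro _ ⟨x, rfl⟩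
    exact ⟨s' x, (Scheme.Hom.comp_apply _ _ x).symm⟩
  · rintro _ ⟨v, rfl⟩
    obtain ⟨x, rfl⟩ := (asIso s').hom.surjective v
    exact ⟨x, Scheme.Hom.comp_apply _ _ x⟩

include hγ in
/-- **The square `V → im(γ)`, `𝟙`, `im(γ) → Y`, `j` is cartesian** (`im(γ) → Y` is an
isomorphism over `j(V)` with preimage `V`). [cite: StacksProject, Tag 01RH] -/
theorem isPullback_toImage [QuasiCompact j] :
    IsPullback γ.toImage (𝟙 V) (γ.imageι ≫ π) j := by
  obtain ⟨hs, hrange⟩ := isOpenImmersion_toImage_and_range j π γ hγ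
  haveI := hs
  refine (IsOpenImmersion.isPullback (𝟙 V) γ.toImage j (γ.imageι ≫ π)
    (by rw [Category.id_comp, Scheme.Hom.toImage_imageι_assoc, hγ]) ?_).flip
  ext1
  rw [Scheme.Hom.coe_opensRange, hrange]

end GraphClosure

end Literature.AlgebraicGeometry.Morphisms

end
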